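import Literature.NumberTheory.Sieve.FriedlanderIwaniecSpinCharSums
import HarnessLib

/-!
# Friedlander–Iwaniec, *The polynomial `X² + Y⁴` captures its primes*: Proposition 17.2, `S^k_χ(β') ≪ N^{1-δ}` (the assembly of §25)

Family `parity` (Line A of the FI `a² + b⁴` completion, node (vi): Propositions 17.2–17.3).
Source: J. Friedlander, H. Iwaniec, Ann. of Math. (2) 148 (1998), 945–1040
[FriedlanderIwaniecAnnals1998] (= arXiv:math/9811185). Proposition 17.2 (arXiv p. 68): "For every
character (17.17) [`ψ(z) = χ(z)(z/|z|)^k`, `χ` a character of `(ℤ[i]/4dℤ[i])^*`] we have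
(17.18) `S^k_χ(β') ≪ N^{1-δ}` uniformly in `d(|k|+1) ≤ N^δ` for some positive constant `δ`."
Here (17.14)–(17.15), (25.1)–(25.2): `S^k_χ(β') = Σ_{(n,Π)=1} g(n) μ(n) γ(n) λ(n)`,
`γ(n) = Σ_{c∣n, c≤C} μ(c)`, `1 ≤ C ≤ N^{1-η}`, `g` "a smooth function supported on
`N' ≤ m ≤ (1+θ)N'` with `N < N' < 2N` and satisfying `g^{(j)} ≪ (θN)^{-j}` for `j = 0, 1, 2`",
`λ(n)` the quadratic eigenvalue (23.1) [tree: `quadEigenvalue d χ k n`].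

## What is here (everything PROVED; no named facts)

* `SpinCharSum.norm_midRange_le` — the middle range `C₀ < c ≤ C` of (25.3)–(25.4), all dyadic blocks
  [from `SpinCharSum.norm_midBlock_le`];
* `SpinCharSum.sepParams_spec` — the parameters (24.9)–(24.10) with `r = 120`:
  `z = ⌈x^{1/r²}⌉`, `D = z^{r-1}⌈x^{1/r}⌉`, so that `z^{r(r-1)} x ≤ D^r` and `D ≤ 2^r x^{2/r}`;
* `norm_spinCharSum_le` — **Proposition 17.2 in general form**: for every `η > 0` there are `δ > 0`,
  `K` with `‖Σ_{n ≤ X} ρ_P(n) g(n) μ(n) γ(n, C) λ(n)‖ ≤ K (1 + V(g)) X^{1-δ}` for all `X ≥ 1`, all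
  weight sequences `|g| ≤ 1` vanishing beyond `X` (`V(g)` = total variation), all `C ≤ X^{1-η}`, `P`,
  and all `d ≥ 1`, `χ (mod 4d)`, `k` with `d(|k|+1) ≤ X^δ`; here `δ = min(η, 10⁻⁶)/200`;
* `weightVariation_le_four_of_deriv_le` — the weight of (4.12)–(4.14) has `V(g) ≤ 4`;
* `FriedlanderIwaniec1998_prop172` — **Proposition 17.2 as printed** (smooth weight `p` of (4.13),
  sum `Σ_n β₀(n) λ(n)` with the tree's `fiBeta₀`), a corollary of the general form.

## The argument (§25 of the source, arXiv pp. 83–84, followed step by step)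

Write `S = Σ_{c ≤ C} μ(c)ρ(c)μ(c) S_c` [`spinCharSum_eq_sum_innerSum`]. Middle range
`C₀ = ⌈X^{η₀}⌉ < c ≤ C` (`η₀ = 10⁻⁶`): dyadic blocks in `c`, each a restricted bilinear form `ℒ*`
bounded by Proposition 23.1 [`norm_midRange_le`; the coprimality `(c, ℓ) = 1` is removed by Möbius
truncated at `B₀ = ⌈X^{η₁/24}⌉`, `η₁ = min(η, η₀)`], total `≪ (1+V) X^{1-η₁/24+3ε}`. Small range
`c ≤ C₀`: for each `c`, Proposition 24.2 with `x = X/c`, `r = 120` splits `S_c` into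
`Σ_𝔡 T(c,𝔡) + T(c) + S(c)` [`norm_innerSum_small_le`], bounded respectively through Proposition 23.1
(`≪ X^{23/24 + 4/r + …}`), Proposition 23.1 again (`≪ X^{1 - 1/(12 r²) + …}`) and Theorem 2^ψ with
`ϑ = 1 - 1/1250` (`≪ X^{ϑ + 2/r² + …}`); with `ε = δ = η₁/200` every exponent is `≤ 1 - δ - η₀`, and the
`C₀ ≤ 2X^{η₀}` values of `c` give `≪ (1+V) X^{1-δ}`. The bookkeeping is done with bounds of the shape
`q ≤ k·X^a` (`bound_mul`, `bound_mono`).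

Deviations from the printed proof (Proposition 17.2 only claims SOME `δ > 0`, so they are harmless):
(i) Proposition 23.1 is used in the `c^{1+ε}` form PROVED in the tree [`norm_bilinear_quadEigenvalue_le`]
rather than the printed `τ(c)` form, whence `r = 120` and the tiny exponents; (ii) the weight `g(cmn)` is
separated by Abel summation over its total variation [`BilinBoundedBy.bvWeight`] instead of a Mellin
transform, so no smoothness of `g` is needed and the printed hypothesis (4.14) enters only through
`V(g) ≤ 4`; (iii) in the printed form we assume `θN ≥ 1` (in the source `θ = (log x)^{-A'}` and
`N > x^{1/4}`, (4.15), (5.2)) and use (4.14) for `j = 0, 1` only, with implied constants `1`.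

## References

* J. Friedlander, H. Iwaniec, Ann. of Math. (2) 148 (1998), 945–1040: §4 (4.12)–(4.14); §17
  (17.14)–(17.18), Proposition 17.2; §23 Proposition 23.1; §24 (24.9)–(24.10), Proposition 24.2; §25;
  §26 Theorem 2^ψ. [FriedlanderIwaniecAnnals1998]

## Tree / Mathlib

Tree: everything of `FriedlanderIwaniecSpinCharSums` (`spinCharSum`, `fiBeta₀`, `weightVariation`,
`SpinCharSum.innerSum`, `norm_midBlock_le`, `norm_innerSum_small_le`, `bilinBoundedBy_quadEigenvalue`,
`fiBeta₀_eq_roughInd_mul`), `FriedlanderIwaniec1998_theorem2psiWith_holds` (`…SpinTheorem2Psi`),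
`norm_quadEigenvalue_le`, `exists_card_divisors_le_mul_rpow` (`DivisorBound`), `quadEigenvalue`,
`vonMangoldtEigenSum` (`FriedlanderIwaniecSpin`). Mathlib: `Convex.norm_image_sub_le_of_norm_deriv_le`
(mean value inequality), `Real.log_le_rpow_div`, `Nat.pow_log_le_self`, `Nat.lt_pow_succ_log_self`.
-/

noncomputable section

open Finset Real
open scoped NumberTheorySymbols ArithmeticFunction.Moebius ArithmeticFunction.vonMangoldt
  ArithmeticFunction.Omega ArithmeticFunction.omega

namespace Literature.NumberTheory.Sieve.FriedlanderIwaniecPrimes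

open Literature.NumberTheory.QuadraticFields.GaussianPrimary

namespace SpinCharSum

/-! ### The middle range, all dyadic blocks -/

/-- **The middle range `C₀ < c ≤ C`** ((25.3)–(25.4)), all dyadic blocks: for `1 ≤ c₀`, `c₁ ≤ X`,
coefficients `|a(c)| ≤ 1`, a weight `g` vanishing beyond `X` with `|g| ≤ 1`, a uniform divisor bound
`T` on `[1, X]` and `B₀ ≥ 1`,
`‖Σ_{c₀ < c ≤ c₁} a(c) S_c‖ ≤ (log₂ c₁ + 1) · (B₀ V log(6X) C (2c₁ + X/c₀)^{1/12} (2X)^{11/12+ε} + 2T²X/B₀)`.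
[cite: FriedlanderIwaniecAnnals1998, (25.3)-(25.4)] -/
theorem norm_midRange_le {ε : ℝ} {C : ℝ} (hC0 : 0 ≤ C) (hε : 0 ≤ ε)
    (hC : ∀ d : ℕ, 1 ≤ d → ∀ χ : MulChar (GaussQuot (4 * d)) ℂ, ∀ k : ℤ,
      ∀ c : ℕ, 1 ≤ c → ∀ M₀ N₀ : ℕ, 1 ≤ M₀ → 1 ≤ N₀ → ∀ W Z : Finset ℕ, W ⊆ Icc 1 M₀ → Z ⊆ Icc 1 N₀ →
        BilinBoundedBy (fun m n => quadEigenvalue d χ k (c * m * n)) W Z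
          (C * (c : ℝ) ^ (1 + ε) * ((M₀ : ℝ) + N₀) ^ (1 / 12 : ℝ) * ((M₀ : ℝ) * N₀) ^ (11 / 12 + ε)))
    {d : ℕ} (hd : 1 ≤ d) (χ : MulChar (GaussQuot (4 * d)) ℂ) (k : ℤ) {X c₀ c₁ : ℕ} (hc₀ : 1 ≤ c₀)
    (hc₁X : c₁ ≤ X) (g : ℕ → ℂ) (hg0 : ∀ n, X < n → g n = 0) (hg1 : ∀ n, ‖g n‖ ≤ 1) (P : ℝ)
    (a : ℕ → ℂ) (ha : ∀ c, ‖a c‖ ≤ 1) {T : ℝ} (hT : ∀ n, 1 ≤ n → n ≤ X → ((Nat.divisors n).card : ℝ) ≤ T)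
    {B₀ : ℕ} (hB : 1 ≤ B₀) (hX : 1 ≤ X) :
    ‖∑ c ∈ Ioc c₀ c₁, a c * innerSum g P d χ k X c‖ ≤
      (Nat.log 2 c₁ + 1 : ℕ) * (B₀ * (weightVariation g X * Real.log (6 * X) *
        (C * (2 * (c₁ : ℝ) + (X : ℝ) / c₀) ^ (1 / 12 : ℝ) * (2 * (X : ℝ)) ^ (11 / 12 + ε))) +
        T ^ 2 * (2 * (X : ℝ) / B₀)) := by
  have hV0 := weightVariation_nonneg g X
  have hX1 : (1 : ℝ) ≤ X := by exact_mod_cast hX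
  have hlog0 : 0 ≤ Real.log (6 * (X : ℝ)) := Real.log_nonneg (by linarith)
  have hc₀0 : (0 : ℝ) < c₀ := by exact_mod_cast hc₀
  set J := Nat.log 2 c₁ + 1 with hJ
  set Bmid : ℝ := B₀ * (weightVariation g X * Real.log (6 * X) *
      (C * (2 * (c₁ : ℝ) + (X : ℝ) / c₀) ^ (1 / 12 : ℝ) * (2 * (X : ℝ)) ^ (11 / 12 + ε))) +
      T ^ 2 * (2 * (X : ℝ) / B₀) with hBmid
  have hBmid0 : 0 ≤ Bmid := by rw [hBmid]; positivity
  -- extend to `Ioc c₀ (c₀ 2^J)` with the indicator `[c ≤ c₁]`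
  set a' : ℕ → ℂ := fun c => if c ≤ c₁ then a c else 0 with ha'
  have ha'1 : ∀ c, ‖a' c‖ ≤ 1 := fun c => by rw [ha']; simp only; split_ifs; exacts [ha c, by simp]
  have hc₁J : c₁ ≤ c₀ * 2 ^ J := by
    have := (Nat.lt_pow_succ_log_self (b := 2) (by norm_num) c₁).le
    exact this.trans (Nat.le_mul_of_pos_left _ hc₀)
  have hext : ∑ c ∈ Ioc c₀ c₁, a c * innerSum g P d χ k X c =
      ∑ c ∈ Ioc c₀ (c₀ * 2 ^ J), a' c * innerSum g P d χ k X c := by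
    rw [← sum_subset (Ioc_subset_Ioc_right hc₁J)]
    · refine sum_congr rfl fun c hc => ?_
      rw [mem_Ioc] at hc; rw [ha']; simp only; rw [if_pos hc.2]
    · intro c hc hc'
      rw [mem_Ioc] at hc
      rw [mem_Ioc, not_and, not_le] at hc'
      have hlt := hc' hc.1
      rw [ha']; simp only; rw [if_neg (by omega), zero_mul]
  rw [hext, Vaughan.sum_Ioc_mul_two_pow_eq_sum]
  have hblock : ∀ i ∈ range J, ‖∑ c ∈ Ioc (c₀ * 2 ^ i) (c₀ * 2 ^ i + c₀ * 2 ^ i),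
      a' c * innerSum g P d χ k X c‖ ≤ Bmid := by
    intro i _
    set A := c₀ * 2 ^ i with hA
    have hA1 : 1 ≤ A := Nat.mul_pos hc₀ Nat.one_le_two_pow
    have hAc₀ : c₀ ≤ A := Nat.le_mul_of_pos_right c₀ Nat.one_le_two_pow
    rw [← two_mul]
    by_cases hAc : c₁ ≤ A
    · -- all coefficients vanish
      rw [sum_eq_zero fun c hc => ?_, norm_zero]
      · exact hBmid0
      rw [mem_Ioc] at hc
      rw [ha']; simp only; rw [if_neg (by omega), zero_mul]
    push Not at hAc
    have hAX : A ≤ X := hAc.le.trans hc₁X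
    have h := norm_midBlock_le hC hd χ k hA1 hAX g hg0 hg1 P a' ha'1 hT hB
    refine h.trans ?_
    rw [hBmid]
    have hA0 : (0 : ℝ) < A := by exact_mod_cast hA1
    have h1 : ((2 * A : ℕ) : ℝ) + ((X / A : ℕ) : ℝ) ≤ 2 * (c₁ : ℝ) + (X : ℝ) / c₀ := by
      have e1 : ((2 * A : ℕ) : ℝ) ≤ 2 * (c₁ : ℝ) := by exact_mod_cast Nat.mul_le_mul_left 2 hAc.le
      have e2 : ((X / A : ℕ) : ℝ) ≤ (X : ℝ) / c₀ :=
        Nat.cast_div_le.trans (div_le_div_of_nonneg_left (by positivity) hc₀0 (by exact_mod_cast hAc₀))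
      linarith
    have h2 : ((2 * A : ℕ) : ℝ) * ((X / A : ℕ) : ℝ) ≤ 2 * (X : ℝ) := by
      have : 2 * A * (X / A) ≤ 2 * X := by rw [mul_assoc]; exact Nat.mul_le_mul_left 2 (Nat.mul_div_le X A)
      exact_mod_cast this
    have hB0' : (0 : ℝ) < B₀ := by exact_mod_cast hB
    have h3 : ((2 * A : ℕ) : ℝ) * ((X / A : ℕ) : ℝ) / B₀ ≤ 2 * (X : ℝ) / B₀ :=
      div_le_div_of_nonneg_right h2 hB0'.le
    have h4 : (((2 * A : ℕ) : ℝ) + ((X / A : ℕ) : ℝ)) ^ (1 / 12 : ℝ) ≤ (2 * (c₁ : ℝ) + (X : ℝ) / c₀) ^ (1 / 12 : ℝ) :=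
      Real.rpow_le_rpow (by positivity) h1 (by norm_num)
    have h5 : (((2 * A : ℕ) : ℝ) * ((X / A : ℕ) : ℝ)) ^ (11 / 12 + ε) ≤ (2 * (X : ℝ)) ^ (11 / 12 + ε) :=
      Real.rpow_le_rpow (by positivity) h2 (by linarith)
    have : 0 ≤ (2 * (c₁ : ℝ) + (X : ℝ) / c₀) ^ (1 / 12 : ℝ) := by positivity
    have : 0 ≤ (2 * (X : ℝ)) ^ (11 / 12 + ε) := by positivity
    gcongr
  calc ‖∑ i ∈ range J, ∑ c ∈ Ioc (c₀ * 2 ^ i) (c₀ * 2 ^ i + c₀ * 2 ^ i), a' c * innerSum g P d χ k X c‖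
      ≤ ∑ i ∈ range J, Bmid := (norm_sum_le _ _).trans (sum_le_sum hblock)
    _ = (J : ℝ) * Bmid := by rw [sum_const, card_range, nsmul_eq_mul]

/-! ### Bookkeeping helpers for the assembly -/

/-- Product of two bounds of the shape `≤ K · Y^a`. [folklore] -/
private theorem bound_mul {Y q₁ q₂ k₁ k₂ a₁ a₂ : ℝ} (hY : 0 < Y) (h₁ : q₁ ≤ k₁ * Y ^ a₁)
    (h₂ : q₂ ≤ k₂ * Y ^ a₂) (hq₁ : 0 ≤ q₁) (hq₂ : 0 ≤ q₂) :
    q₁ * q₂ ≤ (k₁ * k₂) * Y ^ (a₁ + a₂) := by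
  have hk₁ : 0 ≤ k₁ * Y ^ a₁ := hq₁.trans h₁
  calc q₁ * q₂ ≤ (k₁ * Y ^ a₁) * (k₂ * Y ^ a₂) := mul_le_mul h₁ h₂ hq₂ hk₁
    _ = (k₁ * k₂) * Y ^ (a₁ + a₂) := by rw [Real.rpow_add hY]; ring

/-- Raising the exponent in a bound `≤ K · Y^a`, `Y ≥ 1`. [folklore] -/
private theorem bound_mono {Y Q K a b : ℝ} (hY : 1 ≤ Y) (hQ : Q ≤ K * Y ^ a) (hK : 0 ≤ K) (hab : a ≤ b) :
    Q ≤ K * Y ^ b :=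
  hQ.trans (mul_le_mul_of_nonneg_left (Real.rpow_le_rpow_of_exponent_le hY hab) hK)

/-- `x^a ≤ Y^a` for `0 ≤ x ≤ Y`, `0 ≤ a`, in the shape `≤ 1 · Y^a`. [folklore] -/
private theorem bound_of_le {Y x a : ℝ} (hx : 0 ≤ x) (hxY : x ≤ Y) (ha : 0 ≤ a) : x ^ a ≤ 1 * Y ^ a := by
  rw [one_mul]; exact Real.rpow_le_rpow hx hxY ha

/-- `log(6Y) ≤ 6 Y^e / e` for `Y ≥ 1`, `0 < e ≤ 1`. [folklore] -/
private theorem log_six_mul_le {Y e : ℝ} (hY : 1 ≤ Y) (he : 0 < e) (he1 : e ≤ 1) :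
    Real.log (6 * Y) ≤ 6 / e * Y ^ e := by
  have h := Real.log_le_rpow_div (x := 6 * Y) (by positivity) he
  refine h.trans ?_
  rw [Real.mul_rpow (by norm_num) (by positivity), div_eq_mul_inv, div_eq_mul_inv]
  have h6 : (6 : ℝ) ^ e ≤ 6 := by
    calc (6 : ℝ) ^ e ≤ (6 : ℝ) ^ (1 : ℝ) := Real.rpow_le_rpow_of_exponent_le (by norm_num) he1
      _ = 6 := Real.rpow_one 6
  have hYe : 0 ≤ Y ^ e := by positivity
  have he0 : 0 ≤ e⁻¹ := by positivity
  nlinarith [mul_nonneg hYe he0]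

/-- `1 ≤ log(6Y)` for `Y ≥ 1`. [folklore] -/
private theorem one_le_log_six_mul {Y : ℝ} (hY : 1 ≤ Y) : 1 ≤ Real.log (6 * Y) := by
  have h6 : Real.exp 1 ≤ 6 * Y := by
    have := Real.exp_one_lt_d9
    nlinarith
  calc (1 : ℝ) = Real.log (Real.exp 1) := (Real.log_exp 1).symm
    _ ≤ Real.log (6 * Y) := Real.log_le_log (Real.exp_pos 1) h6

/-- `log₂ x + 1 ≤ 3 log(6Y)` for `1 ≤ x ≤ Y`. [folklore] -/
private theorem natLog_two_add_one_le {x : ℕ} {Y : ℝ} (hx : 1 ≤ x) (hxY : (x : ℝ) ≤ Y) :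
    ((Nat.log 2 x + 1 : ℕ) : ℝ) ≤ 3 * Real.log (6 * Y) := by
  have hY : 1 ≤ Y := le_trans (by exact_mod_cast hx) hxY
  have hx0 : (0 : ℝ) < x := by exact_mod_cast hx
  have hlog2 := Real.log_two_gt_d9
  have hpow : ((2 : ℕ) ^ Nat.log 2 x : ℕ) ≤ x := Nat.pow_log_le_self 2 (by omega)
  have h1 : (Nat.log 2 x : ℝ) * Real.log 2 ≤ Real.log x := by
    rw [← Real.log_pow]
    exact Real.log_le_log (by positivity) (by exact_mod_cast hpow)
  have h2 : Real.log (x : ℝ) ≤ Real.log (6 * Y) := Real.log_le_log hx0 (by linarith)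
  have h3 := one_le_log_six_mul hY
  have h4 : (Nat.log 2 x : ℝ) ≤ 2 * Real.log (6 * Y) := by
    have : (Nat.log 2 x : ℝ) * Real.log 2 ≤ Real.log (6 * Y) := h1.trans h2
    nlinarith
  push_cast
  linarith

/-- **The parameters of §25** (`r = 120`): for `x ≥ 1`, `z = ⌈x^{1/r²}⌉`, `w = ⌈x^{1/r}⌉`, `D = z^{r-1} w`:
`1 ≤ z ≤ x`, `x^{1/r²} ≤ z ≤ 2x^{1/r²}`, `1 ≤ D`, `z^{r(r-1)} x ≤ D^r` and `D ≤ 2^r x^{2/r}`.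
[cite: FriedlanderIwaniecAnnals1998, (24.9)-(24.10)] -/
theorem sepParams_spec {x z w D : ℕ} (hx : 1 ≤ x) (hz : z = ⌈(x : ℝ) ^ ((14400 : ℝ)⁻¹)⌉₊)
    (hw : w = ⌈(x : ℝ) ^ ((120 : ℝ)⁻¹)⌉₊) (hDdef : D = z ^ 119 * w) :
    1 ≤ z ∧ z ≤ x ∧ (x : ℝ) ^ ((14400 : ℝ)⁻¹) ≤ z ∧ (z : ℝ) ≤ 2 * (x : ℝ) ^ ((14400 : ℝ)⁻¹) ∧
      1 ≤ D ∧ z ^ (120 * (120 - 1)) * x ≤ D ^ 120 ∧ (D : ℝ) ≤ 2 ^ 120 * (x : ℝ) ^ ((2 : ℝ) / 120) := by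
  have hx1 : (1 : ℝ) ≤ x := by exact_mod_cast hx
  have hx0 : (0 : ℝ) ≤ x := by positivity
  set y : ℝ := (x : ℝ) ^ ((14400 : ℝ)⁻¹) with hy
  set v : ℝ := (x : ℝ) ^ ((120 : ℝ)⁻¹) with hv
  have hy1 : 1 ≤ y := Real.one_le_rpow hx1 (by norm_num)
  have hv1 : 1 ≤ v := Real.one_le_rpow hx1 (by norm_num)
  have hyx : y ≤ x := Real.rpow_le_self_of_one_le hx1 (by norm_num)
  have hz1 : 1 ≤ z := by rw [hz]; exact Nat.one_le_iff_ne_zero.mpr (Nat.ceil_pos.mpr (by linarith)).ne'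
  have hzx : z ≤ x := by rw [hz]; exact Nat.ceil_le.mpr (by exact_mod_cast hyx)
  have hyz : y ≤ z := by rw [hz]; exact Nat.le_ceil y
  have hz2 : (z : ℝ) ≤ 2 * y := by
    rw [hz]; have := Nat.ceil_lt_add_one (by linarith : (0 : ℝ) ≤ y); linarith
  have hw1 : 1 ≤ w := by rw [hw]; exact Nat.one_le_iff_ne_zero.mpr (Nat.ceil_pos.mpr (by linarith)).ne'
  have hvw : v ≤ w := by rw [hw]; exact Nat.le_ceil v
  have hw2 : (w : ℝ) ≤ 2 * v := by
    rw [hw]; have := Nat.ceil_lt_add_one (by linarith : (0 : ℝ) ≤ v); linarith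
  have hD1 : 1 ≤ D := by rw [hDdef]; exact Nat.mul_pos (Nat.pow_pos hz1) hw1
  refine ⟨hz1, hzx, hyz, hz2, hD1, ?_, ?_⟩
  · -- `z^{r(r-1)} x ≤ D^r`: from `x ≤ w^r`
    have hxw : x ≤ w ^ 120 := by
      have h1 : (v : ℝ) ^ (120 : ℕ) = x := by
        rw [hv, show ((120 : ℝ)⁻¹) = ((120 : ℕ) : ℝ)⁻¹ by norm_num]
        exact Real.rpow_inv_natCast_pow hx0 (by norm_num)
      have h2 : (x : ℝ) ≤ (w : ℝ) ^ (120 : ℕ) := by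
        rw [← h1]; exact pow_le_pow_left₀ (by linarith) hvw 120
      exact_mod_cast h2
    rw [hDdef, show 120 * (120 - 1) = 119 * 120 by norm_num, pow_mul, mul_pow]
    exact Nat.mul_le_mul_left _ hxw
  · -- `D ≤ 2^r x^{2/r}`
    rw [hDdef]
    push_cast
    have hz0 : (0 : ℝ) ≤ z := by positivity
    have h1 : ((z : ℝ)) ^ (119 : ℕ) ≤ (2 * y) ^ (119 : ℕ) := pow_le_pow_left₀ hz0 hz2 119
    have h2 : (2 * y) ^ (119 : ℕ) = 2 ^ (119 : ℕ) * (x : ℝ) ^ ((119 : ℝ) / 14400) := by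
      rw [mul_pow, hy, ← Real.rpow_natCast ((x : ℝ) ^ ((14400 : ℝ)⁻¹)) 119, ← Real.rpow_mul hx0]
      norm_num
    have h3 : (x : ℝ) ^ ((119 : ℝ) / 14400) * v ≤ (x : ℝ) ^ ((2 : ℝ) / 120) := by
      rw [hv, ← Real.rpow_add (by linarith)]
      exact Real.rpow_le_rpow_of_exponent_le hx1 (by norm_num)
    have hxp : 0 ≤ (x : ℝ) ^ ((119 : ℝ) / 14400) := by positivity
    calc ((z : ℝ)) ^ (119 : ℕ) * (w : ℝ) ≤ (2 * y) ^ (119 : ℕ) * (2 * v) :=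
          mul_le_mul h1 hw2 (by positivity) (by positivity)
      _ = 2 ^ (120 : ℕ) * ((x : ℝ) ^ ((119 : ℝ) / 14400) * v) := by rw [h2]; ring
      _ ≤ 2 ^ (120 : ℕ) * (x : ℝ) ^ ((2 : ℝ) / 120) := mul_le_mul_of_nonneg_left h3 (by positivity)

/-- `(V + 4)/log 2 ≤ 8 (1 + V)` for `V ≥ 0`. [folklore] -/
private theorem var_factor_le {V : ℝ} (hV : 0 ≤ V) : (V + 4) / Real.log 2 ≤ 8 * (1 + V) := by
  have hlog2 := Real.log_two_gt_d9
  rw [div_le_iff₀ (by linarith)]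
  nlinarith

end SpinCharSum

set_option maxHeartbeats 2000000 in
open SpinCharSum in
/-- **Friedlander–Iwaniec, Proposition 17.2 — general form.** For every `η > 0` there are `δ > 0` and
`K` such that for all `X ≥ 1`, every weight sequence `g` with `|g| ≤ 1` vanishing beyond `X`, all real
`C ≤ X^{1-η}` and `P`, and every Hecke character `ψ = χ (z/|z|)^k` (`χ` mod `4d`) with
`d(|k|+1) ≤ X^δ`,
`‖Σ_{n ≤ X} ρ_P(n) g(n) μ(n) γ(n, C) λ(n)‖ ≤ K (1 + V(g)) X^{1-δ}`,
`V(g)` the total variation of `g` (for the smooth `g = p` of (4.13) supported on `(N', (1+θ)N']`,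
`V(g) ≤ 4`: this is (17.18) `S^k_χ(β') ≪ N^{1-δ}`). The proof is §25 of the source with the tree's
`c^{1+ε}` form of Proposition 23.1, `r = 120`, `z = ⌈x^{1/r²}⌉`, and
`δ = min(η, 10⁻⁶)/200`. [cite: FriedlanderIwaniecAnnals1998, Proposition 17.2] -/
theorem norm_spinCharSum_le {η : ℝ} (hη : 0 < η) :
    ∃ δ : ℝ, 0 < δ ∧ ∃ K : ℝ, 0 < K ∧ ∀ X : ℕ, 1 ≤ X → ∀ g : ℕ → ℂ, (∀ n, ‖g n‖ ≤ 1) →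
      (∀ n, X < n → g n = 0) → ∀ C P : ℝ, C ≤ (X : ℝ) ^ (1 - η) →
      ∀ d : ℕ, 1 ≤ d → ∀ χ : MulChar (GaussQuot (4 * d)) ℂ, ∀ k : ℤ,
        (d * (|k| + 1) : ℝ) ≤ (X : ℝ) ^ δ →
        ‖spinCharSum g C P d χ k X‖ ≤ K * (1 + weightVariation g X) * (X : ℝ) ^ (1 - δ) := by
  -- the constants
  set η₀ : ℝ := 1 / 10 ^ 6 with hη₀
  set η₁ : ℝ := min η η₀ with hη₁
  have hη₁0 : 0 < η₁ := lt_min hη (by rw [hη₀]; norm_num)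
  have hη₁η : η₁ ≤ η := min_le_left _ _
  have hη₁η₀ : η₁ ≤ η₀ := min_le_right _ _
  set e : ℝ := η₁ / 200 with hedef
  have he : 0 < e := by rw [hedef]; positivity
  have he8 : e ≤ 1 / 10 ^ 8 := by rw [hedef, hη₀] at *; linarith
  have he1 : e ≤ 1 := he8.trans (by norm_num)
  have hη₁e : η₁ = 200 * e := by rw [hedef]; ring
  obtain ⟨C, hC0, hC⟩ := bilinBoundedBy_quadEigenvalue (ε := e) he
  obtain ⟨Cτ, hCτ1, hCτ⟩ := Literature.NumberTheory.Sieve.exists_card_divisors_le_mul_rpow (ε := e) he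
  obtain ⟨Cψ₀, hψ₀⟩ := FriedlanderIwaniec1998_theorem2psiWith_holds
  set Cψ : ℝ := max Cψ₀ 0 with hCψdef
  have hCψ0 : 0 ≤ Cψ := le_max_right _ _
  set ϑ : ℝ := 1 - 1 / 1250 with hϑdef
  have hϑ0 : 0 ≤ ϑ := by rw [hϑdef]; norm_num
  have hCτ0 : 0 ≤ Cτ := zero_le_one.trans hCτ1
  -- constants of the six small-range terms and the two middle-range terms
  set A : ℝ := (2 : ℝ) ^ (120 : ℕ) with hAdef
  have hA0 : 0 < A := pow_pos two_pos _
  have hA1 : 1 ≤ A := one_le_pow₀ (by norm_num)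
  set K₁ : ℝ := A * (6 / e) * C * (2 * A) ^ 2 * 2 * 1 with hK₁
  set K₂ : ℝ := 18 / e * (6 / e) * C * 4 * 4 * 2 with hK₂
  set K₃ : ℝ := 18 / e * (4 * Cτ) * 1 with hK₃
  set K₄ : ℝ := 2 * (2 * Cψ) * 4 * 1 * 1 with hK₄
  set K₅ : ℝ := 2 * (2 * Cτ) * 2 * (6 / e) with hK₅
  set K₆ : ℝ := 2 * 2 * Cτ with hK₆
  set Ksm : ℝ := K₁ + K₂ + K₃ + 8 * K₄ + 8 * K₅ + K₆ with hKsm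
  set K₇ : ℝ := 18 / e * 2 * (6 / e) * C * 3 * 2 with hK₇
  set K₈ : ℝ := 18 / e * Cτ ^ 2 * 2 with hK₈
  set Kmid : ℝ := K₇ + K₈ with hKmid
  have hK₁0 : 0 ≤ K₁ := by rw [hK₁]; positivity
  have hK₂0 : 0 ≤ K₂ := by rw [hK₂]; positivity
  have hK₃0 : 0 ≤ K₃ := by rw [hK₃]; positivity
  have hK₄0 : 0 ≤ K₄ := by rw [hK₄]; positivity
  have hK₅0 : 0 ≤ K₅ := by rw [hK₅]; positivity
  have hK₆0 : 0 ≤ K₆ := by rw [hK₆]; positivity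
  have hKsm0 : 0 ≤ Ksm := by rw [hKsm]; positivity
  have hK₇0 : 0 ≤ K₇ := by rw [hK₇]; positivity
  have hK₈0 : 0 ≤ K₈ := by rw [hK₈]; positivity
  have hKmid0 : 0 ≤ Kmid := by rw [hKmid]; positivity
  refine ⟨e, he, 2 * Ksm + Kmid + 1, by positivity, ?_⟩
  intro X hX g hg1 hg0 C' P hC' d hd χ k hfrak
  -- notation
  set Y : ℝ := (X : ℝ) with hYdef
  have hY1 : 1 ≤ Y := by rw [hYdef]; exact_mod_cast hX
  have hY0 : 0 < Y := by linarith
  set V : ℝ := weightVariation g X with hVdef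
  have hV0 : 0 ≤ V := weightVariation_nonneg g X
  set L : ℝ := Real.log (6 * Y) with hLdef
  have hL : L ≤ 6 / e * Y ^ e := log_six_mul_le hY1 he he1
  have hL1 : 1 ≤ L := one_le_log_six_mul hY1
  have hL0 : 0 ≤ L := zero_le_one.trans hL1
  -- divisor bounds
  set T : ℝ := Cτ * Y ^ e with hTdef
  have hT : ∀ n, 1 ≤ n → n ≤ X → ((Nat.divisors n).card : ℝ) ≤ T := by
    intro n hn1 hnX
    refine (hCτ n (by omega)).trans (mul_le_mul_of_nonneg_left ?_ hCτ0)
    exact Real.rpow_le_rpow (by positivity) (by rw [hYdef]; exact_mod_cast hnX) he.le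
  set T₂ : ℝ := Cτ * Y ^ (2 * e) with hT₂def
  have hT₂ : ∀ m, 1 ≤ m → m ≤ X * X → ‖quadEigenvalue d χ k m‖ ≤ T₂ := by
    intro m hm1 hmX
    refine (norm_quadEigenvalue_le d hd χ k m).trans ((hCτ m (by omega)).trans
      (mul_le_mul_of_nonneg_left ?_ hCτ0))
    have : (m : ℝ) ≤ Y ^ (2 : ℝ) := by
      rw [Real.rpow_two, hYdef]; exact_mod_cast (by nlinarith : m ≤ X ^ 2)
    calc (m : ℝ) ^ e ≤ (Y ^ (2 : ℝ)) ^ e := Real.rpow_le_rpow (by positivity) this he.le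
      _ = Y ^ (2 * e) := by rw [← Real.rpow_mul hY0.le]
  -- Theorem 2^ψ with a nonnegative constant
  have hψ : ∀ c' : ℕ, 1 ≤ c' → ∀ t : ℝ, 2 ≤ t →
      ‖vonMangoldtEigenSum d χ k c' t‖ ≤ Cψ * c' * (d * (|k| + 1 : ℝ)) * t ^ ϑ := by
    intro c' hc' t ht
    refine (hψ₀ d hd χ k c' hc' t ht).trans ?_
    have : 0 ≤ (c' : ℝ) * (d * (|k| + 1 : ℝ)) * t ^ ϑ := by
      have : (0 : ℝ) ≤ t := by linarith
      positivity
    nlinarith [le_max_left Cψ₀ 0]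
  -- the ranges
  set c₁ : ℕ := ⌊C'⌋₊ with hc₁def
  have hc₁Y : (c₁ : ℝ) ≤ Y ^ (1 - η) := by
    rcases le_or_gt 0 C' with h | h
    · exact (Nat.floor_le h).trans hC'
    · rw [hc₁def, Nat.floor_of_nonpos h.le, Nat.cast_zero]; positivity
  have hc₁X : c₁ ≤ X := by
    have : (c₁ : ℝ) ≤ Y := hc₁Y.trans (Real.rpow_le_self_of_one_le hY1 (by linarith))
    rw [hYdef] at this; exact_mod_cast this
  set c₀ : ℕ := ⌈Y ^ η₀⌉₊ with hc₀def
  have hYη₀ : 1 ≤ Y ^ η₀ := Real.one_le_rpow hY1 (by rw [hη₀]; norm_num)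
  have hc₀1 : 1 ≤ c₀ := Nat.one_le_iff_ne_zero.mpr (Nat.ceil_pos.mpr (by linarith)).ne'
  have hc₀le : (c₀ : ℝ) ≤ 2 * Y ^ η₀ := by
    have := Nat.ceil_lt_add_one (by linarith : (0 : ℝ) ≤ Y ^ η₀); rw [hc₀def]; linarith
  have hc₀ge : Y ^ η₀ ≤ c₀ := Nat.le_ceil _
  set m : ℕ := min c₀ c₁ with hmdef
  -- the expansion and the split
  rw [spinCharSum_eq_sum_innerSum]
  set a : ℕ → ℂ := fun c => (μ c : ℂ) * (roughInd P c * (μ c : ℂ)) with hadef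
  have ha1 : ∀ c, ‖a c‖ ≤ 1 := fun c => by
    rw [hadef]; simp only; rw [norm_mul, norm_mul]
    have hμ : ‖(μ c : ℂ)‖ ≤ 1 := by rw [Complex.norm_intCast]; exact_mod_cast ArithmeticFunction.abs_moebius_le_one
    exact mul_le_one₀ hμ (by positivity) (mul_le_one₀ (norm_roughInd_le P c) (norm_nonneg _) hμ)
  have hIcc : Icc 1 c₁ = Ioc 0 c₁ := by ext c; simp only [mem_Icc, mem_Ioc]; omega
  rw [hIcc, ← sum_Ioc_consecutive _ (Nat.zero_le m) (min_le_right c₀ c₁ : m ≤ c₁)]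
  change ‖(∑ c ∈ Ioc 0 m, a c * innerSum g P d χ k X c) + ∑ c ∈ Ioc m c₁, a c * innerSum g P d χ k X c‖ ≤ _
  refine (norm_add_le _ _).trans ?_
  -- ### the small range: the per-`c` bound
  have hT0 : 0 ≤ T := by rw [hTdef]; positivity
  have hT₂0 : 0 ≤ T₂ := by rw [hT₂def]; positivity
  have hV1 : V ≤ 1 + V := by linarith
  have hW : (V + 4) / Real.log 2 ≤ 8 * (1 + V) := var_factor_le hV0
  have hW0 : 0 ≤ (V + 4) / Real.log 2 := by positivity
  have bL : L ≤ 6 / e * Y ^ e := hL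
  have bC : C ≤ C * Y ^ (0 : ℝ) := by rw [Real.rpow_zero, mul_one]
  have bCψ : Cψ ≤ Cψ * Y ^ (0 : ℝ) := by rw [Real.rpow_zero, mul_one]
  have bT : T ≤ Cτ * Y ^ e := hTdef.le
  have bT₂ : T₂ ≤ Cτ * Y ^ (2 * e) := hT₂def.le
  have bfrak : (d * (|k| + 1) : ℝ) ≤ 1 * Y ^ e := by rw [one_mul]; exact hfrak
  have hsmall_c : ∀ c ∈ Ioc 0 m, ‖innerSum g P d χ k X c‖ ≤ Ksm * ((1 + V) * Y ^ (1 - e - η₀)) := by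
    intro c hc
    rw [mem_Ioc] at hc
    have hc1 : 1 ≤ c := hc.1
    have hcc₀ : c ≤ c₀ := hc.2.trans (min_le_left _ _)
    have hcX : c ≤ X := (hc.2.trans (min_le_right _ _)).trans hc₁X
    have hcY : (c : ℝ) ≤ 2 * Y ^ η₀ := le_trans (by exact_mod_cast hcc₀) hc₀le
    have hc0 : (0 : ℝ) < c := by exact_mod_cast hc1
    have hx1 : 1 ≤ X / c := Nat.div_pos hcX hc1
    have hxX : X / c ≤ X := Nat.div_le_self X c
    -- parameters `z`, `D`
    obtain ⟨z, D, hz1, hzx, hzge, hzle, hD1, hD, hDle⟩ : ∃ z D : ℕ, 1 ≤ z ∧ z ≤ X / c ∧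
        ((X / c : ℕ) : ℝ) ^ ((14400 : ℝ)⁻¹) ≤ z ∧ (z : ℝ) ≤ 2 * ((X / c : ℕ) : ℝ) ^ ((14400 : ℝ)⁻¹) ∧
        1 ≤ D ∧ z ^ (120 * (120 - 1)) * (X / c) ≤ D ^ 120 ∧
        (D : ℝ) ≤ A * ((X / c : ℕ) : ℝ) ^ ((2 : ℝ) / 120) :=
      ⟨_, _, sepParams_spec hx1 rfl rfl rfl⟩
    have hz0 : (0 : ℝ) < z := by exact_mod_cast hz1
    have hT₂' : ∀ m', 1 ≤ m' → m' ≤ c * z * (X / c) → ‖quadEigenvalue d χ k m'‖ ≤ T₂ := by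
      intro m' hm1 hm
      refine hT₂ m' hm1 (hm.trans ?_)
      calc c * z * (X / c) = z * (c * (X / c)) := by ring
        _ ≤ X * X := Nat.mul_le_mul (hzx.trans hxX) (Nat.mul_div_le X c)
    have hraw := norm_innerSum_small_le hC0.le hC he.le hd χ k hc1 hcX g hg0 hg1 P (r := 120)
      (by norm_num) hz1 hzx hD1 hD hT hϑ0 hCψ0 hψ hT₂'
    rw [← hYdef, ← hVdef, ← hLdef] at hraw
    generalize hx : X / c = x at hraw hzge hzle hzx hD hx1 hxX hDle
    refine hraw.trans ?_
    have hxR1 : (1 : ℝ) ≤ x := by exact_mod_cast hx1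
    have hxR0 : (0 : ℝ) < x := by linarith
    have hxY : (x : ℝ) ≤ Y := by rw [hYdef]; exact_mod_cast hxX
    -- the individual factor bounds, all in the shape `≤ k · Y^a`
    have bD : (D : ℝ) ≤ A * Y ^ ((2 : ℝ) / 120) :=
      hDle.trans (mul_le_mul_of_nonneg_left (Real.rpow_le_rpow hxR0.le hxY (by norm_num)) hA0.le)
    have bcD : (((c * D : ℕ) : ℝ)) ^ (1 + e) ≤ (2 * A) ^ 2 * Y ^ ((η₀ + 2 / 120) * (1 + e)) := by
      have h1 : ((c * D : ℕ) : ℝ) ≤ (2 * A) * Y ^ (η₀ + 2 / 120) := by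
        push_cast
        calc (c : ℝ) * D ≤ (2 * Y ^ η₀) * (A * Y ^ ((2 : ℝ) / 120)) :=
              mul_le_mul hcY bD (by positivity) (by positivity)
          _ = (2 * A) * Y ^ (η₀ + 2 / 120) := by rw [Real.rpow_add hY0]; ring
      have h2A : (1 : ℝ) ≤ 2 * A := by linarith
      calc (((c * D : ℕ) : ℝ)) ^ (1 + e) ≤ ((2 * A) * Y ^ (η₀ + 2 / 120)) ^ (1 + e) :=
            Real.rpow_le_rpow (by positivity) h1 (by linarith)
        _ = (2 * A) ^ (1 + e) * Y ^ ((η₀ + 2 / 120) * (1 + e)) := by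
            rw [Real.mul_rpow (by positivity) (by positivity), ← Real.rpow_mul hY0.le]
        _ ≤ (2 * A) ^ (2 : ℝ) * Y ^ ((η₀ + 2 / 120) * (1 + e)) := by
            refine mul_le_mul_of_nonneg_right ?_ (by positivity)
            exact Real.rpow_le_rpow_of_exponent_le h2A (by linarith)
        _ = (2 * A) ^ 2 * Y ^ ((η₀ + 2 / 120) * (1 + e)) := by rw [Real.rpow_two]
    have bsq : (2 * Real.sqrt (x : ℝ)) ^ (1 / 12 : ℝ) ≤ 2 * Y ^ ((1 : ℝ) / 24) := by
      rw [Real.mul_rpow (by norm_num) (Real.sqrt_nonneg _), Real.sqrt_eq_rpow, ← Real.rpow_mul hxR0.le]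
      have h2 : (2 : ℝ) ^ (1 / 12 : ℝ) ≤ 2 := Real.rpow_le_self_of_one_le (by norm_num) (by norm_num)
      have h3 : (x : ℝ) ^ (1 / (2 : ℝ) * (1 / 12)) ≤ Y ^ ((1 : ℝ) / 24) := by
        rw [show (1 / (2 : ℝ) * (1 / 12)) = 1 / 24 by norm_num]
        exact Real.rpow_le_rpow hxR0.le hxY (by norm_num)
      exact mul_le_mul h2 h3 (by positivity) (by norm_num)
    have bx1 : ((x : ℝ)) ^ (11 / 12 + e) ≤ 1 * Y ^ (11 / 12 + e) :=
      bound_of_le hxR0.le hxY (by linarith)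
    have bN : ((Nat.log 2 x + 1 : ℕ) : ℝ) ≤ 18 / e * Y ^ e := by
      refine (natLog_two_add_one_le hx1 hxY).trans ?_
      calc 3 * Real.log (6 * Y) = 3 * L := by rw [hLdef]
        _ ≤ 3 * (6 / e * Y ^ e) := by linarith
        _ = 18 / e * Y ^ e := by ring
    have bc : ((c : ℝ)) ^ (1 + e) ≤ 4 * Y ^ (η₀ * (1 + e)) := by
      calc ((c : ℝ)) ^ (1 + e) ≤ (2 * Y ^ η₀) ^ (1 + e) := Real.rpow_le_rpow hc0.le hcY (by linarith)
        _ = (2 : ℝ) ^ (1 + e) * Y ^ (η₀ * (1 + e)) := by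
            rw [Real.mul_rpow (by norm_num) (by positivity), ← Real.rpow_mul hY0.le]
        _ ≤ (2 : ℝ) ^ (2 : ℝ) * Y ^ (η₀ * (1 + e)) := by
            refine mul_le_mul_of_nonneg_right ?_ (by positivity)
            exact Real.rpow_le_rpow_of_exponent_le (by norm_num) (by linarith)
        _ = 4 * Y ^ (η₀ * (1 + e)) := by rw [Real.rpow_two]; norm_num
    have hxz : (x : ℝ) / z ≤ Y ^ (1 - (14400 : ℝ)⁻¹) := by
      have h1 : (x : ℝ) / z ≤ (x : ℝ) / (x : ℝ) ^ ((14400 : ℝ)⁻¹) :=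
        div_le_div_of_nonneg_left hxR0.le (by positivity) hzge
      have h2 : (x : ℝ) / (x : ℝ) ^ ((14400 : ℝ)⁻¹) = (x : ℝ) ^ (1 - (14400 : ℝ)⁻¹) := by
        rw [Real.rpow_sub hxR0, Real.rpow_one]
      rw [h2] at h1
      exact h1.trans (Real.rpow_le_rpow hxR0.le hxY (by norm_num))
    have bxz : (x : ℝ) / z ≤ 1 * Y ^ (1 - (14400 : ℝ)⁻¹) := by rw [one_mul]; exact hxz
    have b4T : 4 * T ≤ 4 * Cτ * Y ^ e := le_of_eq (by rw [hTdef]; ring)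
    have b4xz : (4 * (x : ℝ) / z) ^ (1 / 12 : ℝ) ≤ 4 * Y ^ ((1 - (14400 : ℝ)⁻¹) * (1 / 12)) := by
      have h1 : 4 * (x : ℝ) / z ≤ 4 * Y ^ (1 - (14400 : ℝ)⁻¹) := by
        rw [mul_div_assoc]; linarith [hxz]
      calc (4 * (x : ℝ) / z) ^ (1 / 12 : ℝ) ≤ (4 * Y ^ (1 - (14400 : ℝ)⁻¹)) ^ (1 / 12 : ℝ) :=
            Real.rpow_le_rpow (by positivity) h1 (by norm_num)
        _ = (4 : ℝ) ^ (1 / 12 : ℝ) * Y ^ ((1 - (14400 : ℝ)⁻¹) * (1 / 12)) := by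
            rw [Real.mul_rpow (by norm_num) (by positivity), ← Real.rpow_mul hY0.le]
        _ ≤ 4 * Y ^ ((1 - (14400 : ℝ)⁻¹) * (1 / 12)) := by
            refine mul_le_mul_of_nonneg_right ?_ (by positivity)
            exact Real.rpow_le_self_of_one_le (by norm_num) (by norm_num)
    have b2x : (2 * (x : ℝ)) ^ (11 / 12 + e) ≤ 2 * Y ^ (11 / 12 + e) := by
      calc (2 * (x : ℝ)) ^ (11 / 12 + e) ≤ (2 * Y) ^ (11 / 12 + e) :=
            Real.rpow_le_rpow (by positivity) (by linarith) (by linarith)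
        _ = (2 : ℝ) ^ (11 / 12 + e) * Y ^ (11 / 12 + e) := Real.mul_rpow (by norm_num) hY0.le
        _ ≤ 2 * Y ^ (11 / 12 + e) := by
            refine mul_le_mul_of_nonneg_right ?_ (by positivity)
            exact Real.rpow_le_self_of_one_le (by norm_num) (by linarith)
    have bz : (z : ℝ) ≤ 2 * Y ^ ((14400 : ℝ)⁻¹) :=
      hzle.trans (mul_le_mul_of_nonneg_left
        (Real.rpow_le_rpow hxR0.le hxY (by positivity)) (by norm_num))
    have bcz : ((c * z : ℕ) : ℝ) ≤ 2 * 2 * Y ^ (η₀ + (14400 : ℝ)⁻¹) := by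
      push_cast; exact bound_mul hY0 hcY bz hc0.le hz0.le
    have bxϑ : (x : ℝ) ^ ϑ ≤ 1 * Y ^ ϑ := bound_of_le hxR0.le hxY hϑ0
    have bsqrt : 2 * Real.sqrt (x : ℝ) ≤ 2 * Y ^ (1 / 2 : ℝ) := by
      rw [Real.sqrt_eq_rpow]
      exact mul_le_mul_of_nonneg_left (Real.rpow_le_rpow hxR0.le hxY (by norm_num)) (by norm_num)
    have hlogx0 : 0 ≤ Real.log (x : ℝ) := Real.log_nonneg hxR1
    have blog : Real.log (x : ℝ) ≤ 6 / e * Y ^ e := by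
      refine le_trans ?_ hL
      rw [hLdef]
      exact Real.log_le_log hxR0 (by linarith)
    -- the six terms
    have q1 : (D : ℝ) * (L * (C * (((c * D : ℕ) : ℝ)) ^ (1 + e) *
        (2 * Real.sqrt (x : ℝ)) ^ (1 / 12 : ℝ) * ((x : ℝ)) ^ (11 / 12 + e))) ≤
        K₁ * Y ^ (1 - e - η₀) := by
      have h := bound_mul hY0 bD (bound_mul hY0 bL
        (bound_mul hY0 (bound_mul hY0 (bound_mul hY0 bC bcD hC0.le (by positivity)) bsq
          (by positivity) (by positivity)) bx1 (by positivity) (by positivity))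
        hL0 (by positivity)) (by positivity) (by positivity)
      refine (bound_mono hY1 h (by positivity) (show _ ≤ 1 - e - η₀ by rw [hη₀]; linarith)).trans
        (le_of_eq ?_)
      rw [hK₁]; ring
    have q2 : ((Nat.log 2 x + 1 : ℕ) : ℝ) * (L * (C * ((c : ℝ)) ^ (1 + e) *
        (4 * (x : ℝ) / z) ^ (1 / 12 : ℝ) * (2 * (x : ℝ)) ^ (11 / 12 + e))) ≤
        K₂ * Y ^ (1 - e - η₀) := by
      have h := bound_mul hY0 bN (bound_mul hY0 bL
        (bound_mul hY0 (bound_mul hY0 (bound_mul hY0 bC bc hC0.le (by positivity)) b4xz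
          (by positivity) (by positivity)) b2x (by positivity) (by positivity))
        hL0 (by positivity)) (by positivity) (by positivity)
      refine (bound_mono hY1 h (by positivity) (show _ ≤ 1 - e - η₀ by rw [hη₀]; linarith)).trans
        (le_of_eq ?_)
      rw [hK₂]; ring
    have q3 : ((Nat.log 2 x + 1 : ℕ) : ℝ) * (4 * T * (x : ℝ) / z) ≤ K₃ * Y ^ (1 - e - η₀) := by
      rw [show 4 * T * (x : ℝ) / z = (4 * T) * ((x : ℝ) / z) by ring]
      have h := bound_mul hY0 bN (bound_mul hY0 b4T bxz (by positivity) (by positivity))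
        (by positivity) (by positivity)
      refine (bound_mono hY1 h (by positivity) (show _ ≤ 1 - e - η₀ by rw [hη₀]; linarith)).trans
        (le_of_eq ?_)
      rw [hK₃]; ring
    have q4 : 2 * ((z : ℝ) * (Cψ * ((c * z : ℕ) : ℝ) * (d * (|k| + 1 : ℝ)) * ((x : ℝ)) ^ ϑ)) ≤
        K₄ * Y ^ (1 - e - η₀) := by
      have h := bound_mul hY0 bz (bound_mul hY0 (bound_mul hY0 (bound_mul hY0 bCψ bcz hCψ0
        (by positivity)) bfrak (by positivity) (by positivity)) bxϑ (by positivity) (by positivity))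
        hz0.le (by positivity)
      have h' := bound_mono hY1 h (by positivity)
        (show _ ≤ 1 - e - η₀ by rw [hη₀, hϑdef]; linarith)
      calc 2 * ((z : ℝ) * (Cψ * ((c * z : ℕ) : ℝ) * (d * (|k| + 1 : ℝ)) * ((x : ℝ)) ^ ϑ)) ≤
          2 * (2 * (Cψ * (2 * 2) * 1 * 1) * Y ^ (1 - e - η₀)) := by linarith
        _ = K₄ * Y ^ (1 - e - η₀) := by rw [hK₄]; ring
    have q5 : 2 * ((z : ℝ) * (T₂ * (2 * Real.sqrt (x : ℝ) * Real.log (x : ℝ)))) ≤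
        K₅ * Y ^ (1 - e - η₀) := by
      have h := bound_mul hY0 bz (bound_mul hY0 bT₂ (bound_mul hY0 bsqrt blog (by positivity)
        hlogx0) hT₂0 (by positivity)) hz0.le (by positivity)
      have h' := bound_mono hY1 h (by positivity)
        (show _ ≤ 1 - e - η₀ by rw [hη₀]; linarith)
      calc 2 * ((z : ℝ) * (T₂ * (2 * Real.sqrt (x : ℝ) * Real.log (x : ℝ)))) ≤
          2 * (2 * (Cτ * (2 * (6 / e))) * Y ^ (1 - e - η₀)) := by linarith
        _ = K₅ * Y ^ (1 - e - η₀) := by rw [hK₅]; ring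
    have q6 : (z : ℝ) * (c * T₂) ≤ K₆ * Y ^ (1 - e - η₀) := by
      have h := bound_mul hY0 bz (bound_mul hY0 hcY bT₂ hc0.le hT₂0) hz0.le (by positivity)
      refine (bound_mono hY1 h (by positivity) (show _ ≤ 1 - e - η₀ by rw [hη₀]; linarith)).trans
        (le_of_eq ?_)
      rw [hK₆]; ring
    -- assembling
    have hF0 : 0 ≤ Y ^ (1 - e - η₀) := by positivity
    have n1 : 0 ≤ (D : ℝ) * (L * (C * (((c * D : ℕ) : ℝ)) ^ (1 + e) *
        (2 * Real.sqrt (x : ℝ)) ^ (1 / 12 : ℝ) * ((x : ℝ)) ^ (11 / 12 + e))) := by positivity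
    have n2 : 0 ≤ ((Nat.log 2 x + 1 : ℕ) : ℝ) * (L * (C * ((c : ℝ)) ^ (1 + e) *
        (4 * (x : ℝ) / z) ^ (1 / 12 : ℝ) * (2 * (x : ℝ)) ^ (11 / 12 + e))) := by positivity
    have n4 : 0 ≤ 2 * ((z : ℝ) * (Cψ * ((c * z : ℕ) : ℝ) * (d * (|k| + 1 : ℝ)) * ((x : ℝ)) ^ ϑ)) := by
      positivity
    have n5 : 0 ≤ 2 * ((z : ℝ) * (T₂ * (2 * Real.sqrt (x : ℝ) * Real.log (x : ℝ)))) := by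
      have := hlogx0; positivity
    have p1 := mul_le_mul hV1 q1 n1 (by positivity)
    have p2 := mul_le_mul hV1 q2 n2 (by positivity)
    have p4 := mul_le_mul hW q4 n4 (by positivity)
    have p5 := mul_le_mul hW q5 n5 (by positivity)
    have p3 : K₃ * Y ^ (1 - e - η₀) ≤ (1 + V) * (K₃ * Y ^ (1 - e - η₀)) :=
      le_mul_of_one_le_left (by positivity) (by linarith)
    have p6 : K₆ * Y ^ (1 - e - η₀) ≤ (1 + V) * (K₆ * Y ^ (1 - e - η₀)) :=
      le_mul_of_one_le_left (by positivity) (by linarith)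
    rw [hKsm]
    calc _ = V * ((D : ℝ) * (L * (C * (((c * D : ℕ) : ℝ)) ^ (1 + e) *
            (2 * Real.sqrt (x : ℝ)) ^ (1 / 12 : ℝ) * ((x : ℝ)) ^ (11 / 12 + e))))
          + (V * (((Nat.log 2 x + 1 : ℕ) : ℝ) * (L * (C * ((c : ℝ)) ^ (1 + e) *
              (4 * (x : ℝ) / z) ^ (1 / 12 : ℝ) * (2 * (x : ℝ)) ^ (11 / 12 + e))))
             + ((Nat.log 2 x + 1 : ℕ) : ℝ) * (4 * T * (x : ℝ) / z))
          + ((V + 4) / Real.log 2 * (2 * ((z : ℝ) * (Cψ * ((c * z : ℕ) : ℝ) * (d * (|k| + 1 : ℝ)) *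
              ((x : ℝ)) ^ ϑ)))
             + (V + 4) / Real.log 2 * (2 * ((z : ℝ) * (T₂ * (2 * Real.sqrt (x : ℝ) * Real.log (x : ℝ)))))
             + (z : ℝ) * (c * T₂)) := by ring
      _ ≤ (1 + V) * (K₁ * Y ^ (1 - e - η₀)) + ((1 + V) * (K₂ * Y ^ (1 - e - η₀))
             + (1 + V) * (K₃ * Y ^ (1 - e - η₀)))
          + (8 * (1 + V) * (K₄ * Y ^ (1 - e - η₀)) + 8 * (1 + V) * (K₅ * Y ^ (1 - e - η₀))
             + (1 + V) * (K₆ * Y ^ (1 - e - η₀))) :=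
        add_le_add (add_le_add p1 (add_le_add p2 (q3.trans p3)))
          (add_le_add (add_le_add p4 p5) (q6.trans p6))
      _ = _ := by ring
  have hsmall : ‖∑ c ∈ Ioc 0 m, a c * innerSum g P d χ k X c‖ ≤ 2 * Ksm * ((1 + V) * Y ^ (1 - e)) := by
    refine (norm_sum_le _ _).trans ?_
    have h1 : ∀ c ∈ Ioc 0 m, ‖a c * innerSum g P d χ k X c‖ ≤ Ksm * ((1 + V) * Y ^ (1 - e - η₀)) := by
      intro c hc
      rw [norm_mul]
      exact (mul_le_mul (ha1 c) (hsmall_c c hc) (norm_nonneg _) zero_le_one).trans_eq (one_mul _)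
    refine (sum_le_card_nsmul _ _ _ h1).trans ?_
    rw [Nat.card_Ioc, Nat.sub_zero, nsmul_eq_mul]
    have hmY : (m : ℝ) ≤ 2 * Y ^ η₀ := le_trans (by exact_mod_cast min_le_left c₀ c₁) hc₀le
    calc (m : ℝ) * (Ksm * ((1 + V) * Y ^ (1 - e - η₀)))
        ≤ (2 * Y ^ η₀) * (Ksm * ((1 + V) * Y ^ (1 - e - η₀))) :=
          mul_le_mul_of_nonneg_right hmY (by positivity)
      _ = 2 * Ksm * ((1 + V) * (Y ^ η₀ * Y ^ (1 - e - η₀))) := by ring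
      _ = 2 * Ksm * ((1 + V) * Y ^ (1 - e)) := by
          rw [← Real.rpow_add hY0, show η₀ + (1 - e - η₀) = 1 - e by ring]
  -- ### the middle range
  set B₀ : ℕ := ⌈Y ^ (η₁ / 24)⌉₊ with hB₀def
  have hYη₁ : 1 ≤ Y ^ (η₁ / 24) := Real.one_le_rpow hY1 (by positivity)
  have hB₀1 : 1 ≤ B₀ := Nat.one_le_iff_ne_zero.mpr (Nat.ceil_pos.mpr (by linarith)).ne'
  have hB₀le : (B₀ : ℝ) ≤ 2 * Y ^ (η₁ / 24) := by
    have := Nat.ceil_lt_add_one (by linarith : (0 : ℝ) ≤ Y ^ (η₁ / 24)); rw [hB₀def]; linarith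
  have hB₀ge : Y ^ (η₁ / 24) ≤ B₀ := Nat.le_ceil _
  have hmid : ‖∑ c ∈ Ioc m c₁, a c * innerSum g P d χ k X c‖ ≤ Kmid * ((1 + V) * Y ^ (1 - e)) := by
    rcases lt_or_ge c₀ c₁ with hlt | hle
    · have hm : m = c₀ := min_eq_left hlt.le
      rw [hm]
      have hmidraw := norm_midRange_le hC0.le he.le hC hd χ k hc₀1 hc₁X g hg0 hg1 P a ha1 hT hB₀1 hX
      rw [← hYdef, ← hVdef, ← hLdef] at hmidraw
      refine hmidraw.trans ?_
      have hc₁1 : 1 ≤ c₁ := hc₀1.trans hlt.le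
      have hc₁Yle : (c₁ : ℝ) ≤ Y := by rw [hYdef]; exact_mod_cast hc₁X
      have bN₁ : ((Nat.log 2 c₁ + 1 : ℕ) : ℝ) ≤ 18 / e * Y ^ e := by
        refine (natLog_two_add_one_le hc₁1 hc₁Yle).trans ?_
        calc 3 * Real.log (6 * Y) = 3 * L := by rw [hLdef]
          _ ≤ 3 * (6 / e * Y ^ e) := by linarith
          _ = 18 / e * Y ^ e := by ring
      have hc₁η₁ : (c₁ : ℝ) ≤ Y ^ (1 - η₁) :=
        hc₁Y.trans (Real.rpow_le_rpow_of_exponent_le hY1 (by linarith))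
      have hXc₀ : Y / c₀ ≤ Y ^ (1 - η₁) := by
        have h1 : Y / c₀ ≤ Y / Y ^ η₀ := div_le_div_of_nonneg_left hY0.le (by positivity) hc₀ge
        rw [show Y / Y ^ η₀ = Y ^ (1 - η₀) by rw [Real.rpow_sub hY0, Real.rpow_one]] at h1
        exact h1.trans (Real.rpow_le_rpow_of_exponent_le hY1 (by linarith))
      have bsum : (2 * (c₁ : ℝ) + Y / c₀) ^ (1 / 12 : ℝ) ≤ 3 * Y ^ ((1 - η₁) * (1 / 12)) := by
        have h1 : 2 * (c₁ : ℝ) + Y / c₀ ≤ 3 * Y ^ (1 - η₁) := by linarith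
        calc (2 * (c₁ : ℝ) + Y / c₀) ^ (1 / 12 : ℝ) ≤ (3 * Y ^ (1 - η₁)) ^ (1 / 12 : ℝ) :=
              Real.rpow_le_rpow (by positivity) h1 (by norm_num)
          _ = (3 : ℝ) ^ (1 / 12 : ℝ) * Y ^ ((1 - η₁) * (1 / 12)) := by
              rw [Real.mul_rpow (by norm_num) (by positivity), ← Real.rpow_mul hY0.le]
          _ ≤ 3 * Y ^ ((1 - η₁) * (1 / 12)) := by
              refine mul_le_mul_of_nonneg_right ?_ (by positivity)
              exact Real.rpow_le_self_of_one_le (by norm_num) (by norm_num)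
      have b2X : (2 * Y) ^ (11 / 12 + e) ≤ 2 * Y ^ (11 / 12 + e) := by
        calc (2 * Y) ^ (11 / 12 + e) = (2 : ℝ) ^ (11 / 12 + e) * Y ^ (11 / 12 + e) :=
              Real.mul_rpow (by norm_num) hY0.le
          _ ≤ 2 * Y ^ (11 / 12 + e) := by
              refine mul_le_mul_of_nonneg_right ?_ (by positivity)
              exact Real.rpow_le_self_of_one_le (by norm_num) (by linarith)
      have b2XB : 2 * Y / B₀ ≤ 2 * Y ^ (1 - η₁ / 24) := by
        have h1 : 2 * Y / B₀ ≤ 2 * Y / Y ^ (η₁ / 24) :=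
          div_le_div_of_nonneg_left (by positivity) (by positivity) hB₀ge
        rw [show 2 * Y / Y ^ (η₁ / 24) = 2 * Y ^ (1 - η₁ / 24) by
          rw [mul_div_assoc, Real.rpow_sub hY0, Real.rpow_one]] at h1
        exact h1
      have mA : ((Nat.log 2 c₁ + 1 : ℕ) : ℝ) * ((B₀ : ℝ) * (L * (C *
          (2 * (c₁ : ℝ) + Y / c₀) ^ (1 / 12 : ℝ) * (2 * Y) ^ (11 / 12 + e)))) ≤ K₇ * Y ^ (1 - e) := by
        have h := bound_mul hY0 bN₁ (bound_mul hY0 hB₀le (bound_mul hY0 bL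
          (bound_mul hY0 (bound_mul hY0 bC bsum hC0.le (by positivity)) b2X (by positivity)
            (by positivity)) hL0 (by positivity)) (by positivity) (by positivity))
          (by positivity) (by positivity)
        refine (bound_mono hY1 h (by positivity) (show _ ≤ 1 - e by rw [hη₁e]; linarith)).trans
          (le_of_eq ?_)
        rw [hK₇]; ring
      have mB : ((Nat.log 2 c₁ + 1 : ℕ) : ℝ) * (T ^ 2 * (2 * Y / B₀)) ≤ K₈ * Y ^ (1 - e) := by
        rw [sq]
        have h := bound_mul hY0 bN₁ (bound_mul hY0 (bound_mul hY0 bT bT hT0 hT0) b2XB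
          (by positivity) (by positivity)) (by positivity) (by positivity)
        refine (bound_mono hY1 h (by positivity) (show _ ≤ 1 - e by rw [hη₁e]; linarith)).trans
          (le_of_eq ?_)
        rw [hK₈]; ring
      have pA := mul_le_mul hV1 mA (by positivity) (by positivity)
      have pB : K₈ * Y ^ (1 - e) ≤ (1 + V) * (K₈ * Y ^ (1 - e)) :=
        le_mul_of_one_le_left (by positivity) (by linarith)
      rw [hKmid]
      calc _ = V * (((Nat.log 2 c₁ + 1 : ℕ) : ℝ) * ((B₀ : ℝ) * (L * (C *
              (2 * (c₁ : ℝ) + Y / c₀) ^ (1 / 12 : ℝ) * (2 * Y) ^ (11 / 12 + e)))))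
            + ((Nat.log 2 c₁ + 1 : ℕ) : ℝ) * (T ^ 2 * (2 * Y / B₀)) := by ring
        _ ≤ (1 + V) * (K₇ * Y ^ (1 - e)) + (1 + V) * (K₈ * Y ^ (1 - e)) :=
            add_le_add pA (mB.trans pB)
        _ = _ := by ring
    · have hm : m = c₁ := min_eq_right hle
      rw [hm, Finset.Ioc_self, sum_empty, norm_zero]; positivity
  -- ### conclusion
  have hF : 0 ≤ (1 + V) * Y ^ (1 - e) := by positivity
  calc _ ≤ 2 * Ksm * ((1 + V) * Y ^ (1 - e)) + Kmid * ((1 + V) * Y ^ (1 - e)) := add_le_add hsmall hmid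
    _ ≤ (2 * Ksm + Kmid + 1) * (1 + V) * Y ^ (1 - e) := by linarith [hF]

/-- The total variation over the integers of a differentiable weight `p` with `|p'| ≤ (θN)⁻¹`
supported in `(N', (1+θ)N']`, `0 < N' < 2N`, `0 < θ`, `1 ≤ θN`, is at most `4`.
[cite: FriedlanderIwaniecAnnals1998, (4.12)-(4.14)] -/
theorem weightVariation_le_four_of_deriv_le {N : ℕ} {N' θ : ℝ} (hN'0 : 0 < N') (hN'2 : N' < 2 * N)
    (hθ0 : 0 < θ) (hθN : 1 ≤ θ * N) {p : ℝ → ℝ} (hpd : Differentiable ℝ p)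
    (hpsupp : ∀ u, p u ≠ 0 → N' < u ∧ u ≤ (1 + θ) * N') (hp' : ∀ u, |deriv p u| ≤ (θ * N)⁻¹)
    {X : ℕ} (hX : (X : ℝ) ≤ (1 + θ) * N') :
    weightVariation (fun n => ((p n : ℝ) : ℂ)) X ≤ 4 := by
  have hθN0 : 0 < θ * N := by linarith
  have hθN' : θ * N' ≤ 2 * (θ * N) := by nlinarith
  -- support of the differences
  have hzero : ∀ u : ℝ, u ≤ N' → p u = 0 := by
    intro u hu; by_contra h; exact absurd (hpsupp u h).1 (not_lt.mpr hu)
  have hfl : (N' : ℝ) < ⌊N'⌋₊ + 1 := Nat.lt_floor_add_one N'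
  unfold weightVariation
  rw [← sum_filter_of_ne (p := fun y => ⌊N'⌋₊ ≤ y) (fun y hy hne => ?_)]
  · have hterm : ∀ y ∈ (Icc 1 X).filter (fun y => ⌊N'⌋₊ ≤ y),
        ‖((p y : ℝ) : ℂ) - ((p (y + 1 : ℕ) : ℝ) : ℂ)‖ ≤ (θ * N)⁻¹ := by
      intro y _
      rw [← Complex.ofReal_sub, Complex.norm_real, Real.norm_eq_abs, abs_sub_comm]
      have h := convex_univ.norm_image_sub_le_of_norm_deriv_le (f := p) (fun u _ => hpd u)
        (fun u _ => (Real.norm_eq_abs _).le.trans (hp' u)) (Set.mem_univ (y : ℝ))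
        (Set.mem_univ ((y + 1 : ℕ) : ℝ))
      simpa using h
    refine (sum_le_card_nsmul _ _ _ hterm).trans ?_
    rw [nsmul_eq_mul]
    have hsub : (Icc 1 X).filter (fun y => ⌊N'⌋₊ ≤ y) ⊆ Icc ⌊N'⌋₊ X := by
      intro y hy
      simp only [mem_filter, mem_Icc] at hy ⊢
      exact ⟨hy.2, hy.1.2⟩
    have hcard : ((((Icc 1 X).filter (fun y => ⌊N'⌋₊ ≤ y)).card : ℕ) : ℝ) ≤ 4 * (θ * N) := by
      have h1 := card_le_card hsub
      rw [Nat.card_Icc] at h1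
      rcases Nat.eq_zero_or_pos (((Icc 1 X).filter (fun y => ⌊N'⌋₊ ≤ y)).card) with h0 | hpos
      · rw [h0, Nat.cast_zero]; positivity
      · have hflX : ⌊N'⌋₊ ≤ X + 1 := by omega
        have h2 : ((((Icc 1 X).filter (fun y => ⌊N'⌋₊ ≤ y)).card : ℕ) : ℝ) ≤
            (X : ℝ) + 1 - ⌊N'⌋₊ := by
          have := (Nat.cast_le (α := ℝ)).mpr h1
          rw [Nat.cast_sub hflX] at this
          push_cast at this
          linarith
        linarith
    calc ((((Icc 1 X).filter (fun y => ⌊N'⌋₊ ≤ y)).card : ℕ) : ℝ) * (θ * N)⁻¹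
        ≤ 4 * (θ * N) * (θ * N)⁻¹ := mul_le_mul_of_nonneg_right hcard (by positivity)
      _ = 4 := mul_inv_cancel_right₀ hθN0.ne' 4
  · -- outside the support both values vanish
    by_contra hlt
    rw [not_le] at hlt
    have hy1 : ((y + 1 : ℕ) : ℝ) ≤ N' := by
      have h' : ((y + 1 : ℕ) : ℝ) ≤ ⌊N'⌋₊ := by exact_mod_cast hlt
      exact h'.trans (Nat.floor_le hN'0.le)
    have hy0 : ((y : ℕ) : ℝ) ≤ N' := le_trans (by push_cast; linarith) hy1
    exact hne (by simp only [hzero _ hy0, hzero _ hy1, sub_self, norm_zero])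

/-- **Friedlander–Iwaniec, Proposition 17.2** (printed form). "For every character (17.17)
[`ψ(z) = χ(z)(z/|z|)^k`] we have (17.18) `S^k_χ(β') ≪ N^{1-δ}` uniformly in `d(|k|+1) ≤ N^δ` for some
positive constant `δ`", where by (17.14)–(17.15) and (25.1)–(25.2)
`S^k_χ(β') = Σ_{(n,Π)=1} p(n) μ(n) γ(n) λ(n)`, `γ(n) = Σ_{c∣n, c≤C} μ(c)` with `C ≤ N^{1-η}`
(`η > 0` small; `δ` and the implied constant depend on `η`), `λ(n)` the quadratic eigenvalue (23.1) of
`ψ`, and `p` the weight of (4.13): supported on `N' < n ≤ (1+θ)N'` (4.12), `N < N' < 2N`, with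
`p^{(j)} ≪ (θN)^{-j}` (4.14) (here normalised to `|p| ≤ 1`, `|p'| ≤ (θN)⁻¹`; only `j = 0, 1` and
`θN ≥ 1` are used). The summand is the tree's `fiBeta₀ p C P n · quadEigenvalue d χ k n`.
Derived from the general form `norm_spinCharSum_le`.
[cite: FriedlanderIwaniecAnnals1998, Proposition 17.2] -/
theorem FriedlanderIwaniec1998_prop172 {η : ℝ} (hη : 0 < η) :
    ∃ δ : ℝ, 0 < δ ∧ ∃ K : ℝ, 0 < K ∧ ∀ N : ℕ, 1 ≤ N → ∀ N' θ : ℝ, (N : ℝ) < N' → N' < 2 * N →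
      0 < θ → θ ≤ 1 → 1 ≤ θ * N →
      ∀ p : ℝ → ℝ, Differentiable ℝ p → (∀ u, p u ≠ 0 → N' < u ∧ u ≤ (1 + θ) * N') →
      (∀ u, |p u| ≤ 1) → (∀ u, |deriv p u| ≤ (θ * N)⁻¹) →
      ∀ C P : ℝ, C ≤ (N : ℝ) ^ (1 - η) →
      ∀ d : ℕ, 1 ≤ d → ∀ χ : MulChar (GaussQuot (4 * d)) ℂ, ∀ k : ℤ,
        (d * (|k| + 1) : ℝ) ≤ (N : ℝ) ^ δ →
        ‖∑ n ∈ Icc 1 ⌊(1 + θ) * N'⌋₊, ((fiBeta₀ p C P n : ℝ) : ℂ) * quadEigenvalue d χ k n‖ ≤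
          K * (N : ℝ) ^ (1 - δ) := by
  obtain ⟨δ₀, hδ₀, K, hK, hmain⟩ := norm_spinCharSum_le (η := min η (1 / 2)) (lt_min hη one_half_pos)
  set δ : ℝ := min δ₀ (1 / 2) with hδdef
  have hδ : 0 < δ := lt_min hδ₀ one_half_pos
  have hδδ₀ : δ ≤ δ₀ := min_le_left _ _
  have hδ1 : δ ≤ 1 / 2 := min_le_right _ _
  refine ⟨δ, hδ, 20 * K, by positivity, ?_⟩
  intro N hN N' θ hNN' hN'2 hθ0 hθ1 hθN p hpd hpsupp hp1 hp' C P hC d hd χ k hdk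
  have hN1 : (1 : ℝ) ≤ N := by exact_mod_cast hN
  have hN0 : (0 : ℝ) < N := by linarith
  have hN'0 : 0 < N' := by linarith
  set X : ℕ := ⌊(1 + θ) * N'⌋₊ with hXdef
  have hXle : (X : ℝ) ≤ (1 + θ) * N' := Nat.floor_le (by positivity)
  have hNX' : N ≤ X := Nat.le_floor (by nlinarith)
  have hNX : (N : ℝ) ≤ X := by exact_mod_cast hNX'
  have hX1 : 1 ≤ X := hN.trans hNX'
  have hX0 : (0 : ℝ) < X := by linarith
  have hX4 : (X : ℝ) ≤ 4 * N := by nlinarith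
  set g : ℕ → ℂ := fun n => ((p n : ℝ) : ℂ) with hgdef
  have hg1 : ∀ n, ‖g n‖ ≤ 1 := fun n => by
    rw [hgdef]; simp only [Complex.norm_real, Real.norm_eq_abs]; exact hp1 n
  have hg0 : ∀ n, X < n → g n = 0 := by
    intro n hn
    rw [hgdef]; simp only [Complex.ofReal_eq_zero]
    by_contra h
    have h2 := (hpsupp n h).2
    have : n ≤ X := Nat.le_floor h2
    omega
  have hη' : 0 < min η (1 / 2) := lt_min hη one_half_pos
  have hC' : C ≤ (X : ℝ) ^ (1 - min η (1 / 2)) := by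
    refine hC.trans ((Real.rpow_le_rpow_of_exponent_le hN1 (by linarith [min_le_left η (1 / 2)] :
      1 - η ≤ 1 - min η (1 / 2))).trans (Real.rpow_le_rpow hN0.le hNX ?_))
    linarith [min_le_right η (1 / 2)]
  have hdk' : (d * (|k| + 1) : ℝ) ≤ (X : ℝ) ^ δ₀ :=
    hdk.trans ((Real.rpow_le_rpow hN0.le hNX hδ.le).trans
      (Real.rpow_le_rpow_of_exponent_le (by exact_mod_cast hX1) hδδ₀))
  have hS := hmain X hX1 g hg1 hg0 C P hC' d hd χ k hdk'
  have hsum : ∑ n ∈ Icc 1 X, ((fiBeta₀ p C P n : ℝ) : ℂ) * quadEigenvalue d χ k n =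
      spinCharSum g C P d χ k X := by
    unfold spinCharSum
    refine sum_congr rfl fun n _ => ?_
    rw [fiBeta₀_eq_roughInd_mul]
  rw [hsum]
  have hV : weightVariation g X ≤ 4 :=
    weightVariation_le_four_of_deriv_le hN'0 hN'2 hθ0 hθN hpd hpsupp hp' hXle
  have hV0 := weightVariation_nonneg g X
  have hXpow : (X : ℝ) ^ (1 - δ₀) ≤ 4 * (N : ℝ) ^ (1 - δ) := by
    have h1 : (X : ℝ) ^ (1 - δ₀) ≤ (X : ℝ) ^ (1 - δ) :=
      Real.rpow_le_rpow_of_exponent_le (by exact_mod_cast hX1) (by linarith)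
    have h2 : (X : ℝ) ^ (1 - δ) ≤ (4 * N : ℝ) ^ (1 - δ) :=
      Real.rpow_le_rpow hX0.le hX4 (by linarith)
    have h3 : (4 * N : ℝ) ^ (1 - δ) = (4 : ℝ) ^ (1 - δ) * (N : ℝ) ^ (1 - δ) :=
      Real.mul_rpow (by norm_num) hN0.le
    have h4 : (4 : ℝ) ^ (1 - δ) ≤ 4 := Real.rpow_le_self_of_one_le (by norm_num) (by linarith)
    calc (X : ℝ) ^ (1 - δ₀) ≤ (4 : ℝ) ^ (1 - δ) * (N : ℝ) ^ (1 - δ) := by rw [← h3]; exact h1.trans h2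
      _ ≤ 4 * (N : ℝ) ^ (1 - δ) := mul_le_mul_of_nonneg_right h4 (by positivity)
  calc ‖spinCharSum g C P d χ k X‖ ≤ K * (1 + weightVariation g X) * (X : ℝ) ^ (1 - δ₀) := hS
    _ ≤ K * (1 + 4) * (4 * (N : ℝ) ^ (1 - δ)) :=
        mul_le_mul (mul_le_mul_of_nonneg_left (by linarith) hK.le) hXpow (by positivity)
          (by positivity)
    _ = 20 * K * (N : ℝ) ^ (1 - δ) := by ring

end Literature.NumberTheory.Sieve.FriedlanderIwaniecPrimes
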